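import Summits.BirchSwinnertonDyer.Rank1Residual.P2.KrizLiTwoFortyThreeMembership
import Summits.BirchSwinnertonDyer.Rank1Residual.P2.CornerFTwoModelLocalTwo
import Literature.NumberTheory.EllipticCurves.HeegnerHypothesisKroneckerProofs
import HarnessLib

/-!
# Cell `bsd-print-cf2` (D-0131 (2) PRINT TIER, leaf CornerF @ `p = 2`), typer ty2 — the Kriz–Li door at
# `j = 0`, GENERIC SETTING: the shape `y² + y = x³ + a` (`a ∈ ℤ`) and the quadratic field `K`, every
# kernel-checkable hypothesis of Kriz–Li 2019 Thm 5.1 (2) DISCHARGED uniformly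

HONEST FRAMING. Discharge interface (ty2) for the Kriz–Li road on the INERT `j = 0` crux of route
`PrintCf2` (crux `InertJZeroOfFacts`, stmt-BirchSwinnertonDyer-20671). Kriz–Li 2019 Thm 5.1 (2)
(tree `KrizLi2019.thm112_bsdTwo_twist`, typed verbatim) transports `BSD(2)` from `E`, `E^{(d_K)}` to
`E^{(d)}`, `E^{(d·d_K)}` (`d ∈ 𝒩`, `χ_d(−N) = 1`) for `E` with `E(ℚ)[2] = 0`, `c₂(E)` odd, a Heegner
field `K` with `2` split and Assumption (★). The cell's lit seat (DOSSIER §14.4, §14.6) found, besides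
the PRINTED base `243a1` (p3's files `KrizLiTwoFortyThree*`), eight further `j = 0` bases of conductor
`< 5000` at which (★) is CERTIFIED numerically (not printed): `1323a1, 1323m1, 4563a1, 4563b1` (shape
`y² + y = x³ + a`, good at `2`) and `972d1, 1728a1, 1728v1, 3888s1` (shape `y² = x³ + B`, additive at
`2`); and that the door is K-GENERIC (every Heegner field `K` with `2` split at which (★) holds gives a
family). This file discharges, ONCE FOR THE WHOLE SHAPE `⟨0, 0, 1, 0, a⟩` and ONCE FOR EVERY QUADRATIC
`K`, the hypotheses of Thm 5.1 (2) that the kernel can check; the companion files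
`KrizLiJZeroBasesGood.lean` / `KrizLiJZeroBasesBad.lean` add the per-curve facts (minimality,
conductor `< 5000`, a point of infinite order, the Tate algorithm at `2`). NOTHING about (★) is stated
here (it is the consumer's displayed binder, or a certificate record); no named fact is introduced;
nothing is asserted beyond kernel theorems. The leaf is OPEN AS A CLASS.

DISCHARGED HERE, for `E_a : y² + y = x³ + a`, `a ∈ ℤ` (`Δ = −27(4a+1)²`, `c₄ = 0`, `j = 0`):
`E_a` elliptic, CM, `2` INERT in `K_CM = ℚ(√−3)`; **`E_a(ℚ)[2] = 0` for every `a`** (a rational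
`2`-torsion point has `y = −1/2`, `(2x)³ = −2(4a+1)`, impossible `2`-adically); good reduction at `2`,
`c₂ = 1`, so Kriz–Li's local clause holds with a vacuous Manin condition; the quadratic twist
`E_a^{(d)} = y² = x³ + d³(4a+1)/4`; `a_ℓ(E_a)` odd `⟺` `x³ = −16(4a+1)` has an even number of roots
mod `ℓ` (`ℓ ∤ 6(4a+1)`). For a quadratic `K`: `ℓ` splits `⟺ (d_K/ℓ) = 1`, `2` splits `⟺ d_K ≡ 1 (8)`,
the Heegner hypothesis for any `N ∣ B` from the Kronecker symbols at the primes of `B`; `d ∈ 𝒩` from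
explicit conditions on the prime factors; and the sign clause `sgn(d)·(N/|d|) = 1` for `d > 0`,
`d ≡ 1 (mod 12)` whenever `N = 3ᵏ·m²` with `gcd(m, d) = 1`.

References: [KrizLi2019] Thm 5.1 (2) = arXiv:1606.03172 Thm 1.12, Def 4.1, Thm 4.3, §6 Ex. 6.2,
Table 1, Rem. 6.3; [SilvermanAEC2009] III.1, VII.3, VII.5 Prop. 5.1, X.5; [Marcus1977] Ch. 3 Thm 25;
cell dossier `run/shared/lean/pub/bsd-print-cf2/DOSSIER.md` §14.4/§14.6 (certified bases and fields).
-/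

noncomputable section

open scoped Classical

open WeierstrassCurve NumberField Literature.NumberTheory.EllipticCurves
  Literature.NumberTheory.EllipticCurves.Rank1Residual
  Literature.NumberTheory.EllipticCurves.ModularForms
  Summit.BirchSwinnertonDyer.Rank1Residual

set_option autoImplicit false

namespace Summit.BirchSwinnertonDyer.Rank1Residual.P2

/-! ## §1 The shape `E_a : y² + y = x³ + a` -/

/-- **`E_a = [0, 0, 1, 0, a]`**: `y² + y = x³ + a` (`a ∈ ℤ`), the globally-integral `j = 0` shape with
odd discriminant (`243a1`: `a = −1`; `1323a1`: `600`; `1323m1`: `−2`; `4563a1`: `92823`; `4563b1`: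
`42`). [cite: Cremona1997, Table 1 (243a1, 1323a1, 1323m1, 4563a1, 4563b1)] -/
def cubicA₃ (a : ℤ) : WeierstrassCurve ℚ := ⟨0, 0, 1, 0, a⟩

/-- The integer model of `E_a`. [folklore] -/
def cubicA₃Int (a : ℤ) : WeierstrassCurve ℤ := ⟨0, 0, 1, 0, a⟩

variable (a : ℤ)

/-- The integer model maps to the rational one. [folklore] -/
theorem cubicA₃Int_map : (cubicA₃Int a).map (Int.castRingHom ℚ) = cubicA₃ a := by
  ext <;> simp [cubicA₃Int, cubicA₃, WeierstrassCurve.map]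

/-- `E_a` is literally `⟨0, 0, 1, 0, a⟩`. [folklore] -/
theorem cubicA₃_eq : cubicA₃ a = ⟨((0 : ℤ) : ℚ), ((0 : ℤ) : ℚ), ((1 : ℤ) : ℚ), ((0 : ℤ) : ℚ), (a : ℚ)⟩ := by
  simp [cubicA₃]

/-- `Δ(E_a) = −27(4a+1)²`. [folklore] -/
theorem cubicA₃_Δ : (cubicA₃ a).Δ = -27 * (4 * a + 1) ^ 2 := by
  simp only [cubicA₃, WeierstrassCurve.Δ, WeierstrassCurve.b₂, WeierstrassCurve.b₄, WeierstrassCurve.b₆,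
    WeierstrassCurve.b₈]
  ring

/-- `Δ` of the integer model. [folklore] -/
theorem cubicA₃Int_Δ : (cubicA₃Int a).Δ = -27 * (4 * a + 1) ^ 2 := by
  simp only [cubicA₃Int, WeierstrassCurve.Δ, WeierstrassCurve.b₂, WeierstrassCurve.b₄, WeierstrassCurve.b₆,
    WeierstrassCurve.b₈]
  ring

/-- `c₄(E_a) = 0`. [folklore] -/
theorem cubicA₃_c₄ : (cubicA₃ a).c₄ = 0 := by
  simp only [cubicA₃, WeierstrassCurve.c₄, WeierstrassCurve.b₂, WeierstrassCurve.b₄]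
  norm_num

/-- `4a + 1 ≠ 0` (it is odd). [folklore] -/
theorem four_mul_add_one_ne_zero : (4 * (a : ℚ) + 1) ≠ 0 := by
  have h : (4 * a + 1 : ℤ) ≠ 0 := by omega
  exact_mod_cast h

/-- `E_a` is an elliptic curve for every `a ∈ ℤ` (`Δ = −27(4a+1)² ≠ 0`). [folklore] -/
instance isElliptic_cubicA₃ : (cubicA₃ a).IsElliptic := by
  refine ⟨isUnit_iff_ne_zero.mpr ?_⟩
  rw [cubicA₃_Δ]
  exact mul_ne_zero (by norm_num) (pow_ne_zero 2 (four_mul_add_one_ne_zero a))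

/-- `j(E_a) = 0`. [folklore] -/
theorem cubicA₃_j : (cubicA₃ a).j = 0 := by
  rw [WeierstrassCurve.j, cubicA₃_c₄]
  simp

/-- **`E_a` has complex multiplication** (`j = 0`). [cite: SilvermanAEC2009, Appendix C §11, Example 11.3.1] -/
theorem hasCM_cubicA₃ : (cubicA₃ a).HasCM :=
  hasCM_of_j_eq_zero _ (cubicA₃_j a)

/-- **`2` is inert in the CM field of `E_a`** (`K_CM = ℚ(√−3)`). [cite: Cox2013, §5.B Prop. 5.16] -/
theorem cmInert_two_cubicA₃ : CMInert (cubicA₃ a) 2 :=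
  (cmInert_two_iff_of_hasCM (hasCM_cubicA₃ a)).2 (Or.inl (by rw [cubicA₃_j]; simp [cmFieldDiscrOfJ]))

/-! ## §2 `E_a(ℚ)[2] = 0` for EVERY `a ∈ ℤ` -/

/-- **`E_a(ℚ)[2] = 0`** (Kriz–Li's standing hypothesis, tree shape `∀ Q, 2 • Q = 0 → Q = 0`), for every
`a ∈ ℤ`: a rational point of order `2` has `2y + 1 = 0`, so `x³ = −a − 1/4`, i.e. `(2x)³ = −2(4a+1)`
with `4a + 1` odd — but the `2`-adic valuation of a rational cube is divisible by `3`.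
[cite: KrizLi2019, Thm. 5.1 hypothesis "E(ℚ)[2] = 0"] [cite: SilvermanAEC2009, III.2.3 (points of order 2)] -/
theorem twoTorsion_cubicA₃ : ∀ Q : (cubicA₃ a).toAffine.Point, 2 • Q = 0 → Q = 0 := by
  intro Q hQ
  rcases Q with _ | ⟨x, y, hns⟩
  · rfl
  · exfalso
    rw [two_nsmul] at hQ
    have hneg : Affine.Point.some x y hns = -Affine.Point.some x y hns := eq_neg_of_add_eq_zero_left hQ
    rw [Affine.Point.neg_some, Affine.Point.some.injEq] at hneg
    have hy : y = -2⁻¹ := by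
      have h := hneg.2
      simp only [Affine.negY, cubicA₃] at h
      linarith
    have heq := (Affine.equation_iff x y).mp hns.left
    simp only [cubicA₃] at heq
    rw [hy] at heq
    -- `(2x)³ = −2(4a+1)`
    have hcube : (2 * x) ^ 3 = ((-2 * (4 * a + 1) : ℤ) : ℚ) := by push_cast; nlinarith [heq]
    have h0 : (2 * x) ≠ 0 := by
      intro h; rw [h] at hcube; norm_num at hcube
      have : (4 * a + 1 : ℤ) = 0 := by exact_mod_cast (by linarith : (4 * (a : ℚ) + 1) = 0)
      omega
    haveI : Fact (Nat.Prime 2) := ⟨Nat.prime_two⟩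
    have hv := congrArg (padicValRat 2) hcube
    rw [padicValRat.pow, padicValRat.of_int] at hv
    have hval : padicValInt 2 (-2 * (4 * a + 1)) = 1 := by
      rw [show (-2 * (4 * a + 1) : ℤ) = (-(4 * a + 1)) * (2 : ℕ) by push_cast; ring,
        padicValInt_mul_eq_succ _ (by omega), padicValInt.eq_zero_of_not_dvd (by push_cast; omega)]
    rw [hval] at hv
    omega

/-! ## §3 At the prime `2`: good reduction, `c₂ = 1`, Kriz–Li's local clause -/

/-- **`E_a` has good reduction at `2`** (`Δ = −27(4a+1)²` is odd). [cite: SilvermanAEC2009, VII.5 Prop. 5.1(a)] -/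
theorem good_two_cubicA₃' : haveI : Fact (2 : ℕ).Prime := ⟨Nat.prime_two⟩; (cubicA₃ a).HasGoodReductionAtPrime 2 :=
  CornerFTwo.Atlas.good_two_cubicA₃ a

/-- **`c₂(E_a) = 1`** (good reduction). [cite: SilvermanAEC2009, VII.6 (c_p = 1 at good primes)] -/
theorem localTamagawaNumber_two_cubicA₃ :
    haveI : Fact (2 : ℕ).Prime := ⟨Nat.prime_two⟩
    ((cubicA₃ a).baseChange ℚ_[2]).localTamagawaNumber ℤ_[2] = 1 :=
  localTamagawaNumber_padic_eq_one_of_good_holds (cubicA₃ a) 2 (good_two_cubicA₃' a)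

/-- **Kriz–Li's local hypotheses at `2` for `E_a`**: `c₂` odd; the Manin clause is vacuous (good
reduction). [cite: KrizLi2019, Thm. 5.1 hypotheses "c₂(E) odd; Manin constant odd if additive at 2"] -/
theorem krizLi_loc_cubicA₃ {N : ℕ} [NeZero N] (Dt : ModularParametrizationData (cubicA₃ a) N) :
    haveI : Fact (2 : ℕ).Prime := ⟨Nat.prime_two⟩
    Odd (((cubicA₃ a).baseChange ℚ_[2]).localTamagawaNumber ℤ_[2]) ∧
      (¬ (cubicA₃ a).HasGoodReductionAtPrime 2 → ¬ (cubicA₃ a).HasMultiplicativeReductionAtPrime 2 → Odd Dt.c) :=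
  ⟨by rw [localTamagawaNumber_two_cubicA₃]; exact odd_one, fun h _ => absurd (good_two_cubicA₃' a) h⟩

/-! ## §4 Quadratic twists of `E_a`: the model, CM, `2` inert, good at `2` for `d ≡ 1 (mod 4)` -/

/-- **`E_a^{(d)} = y² = x³ + d³(4a+1)/4`** (the tree's `quadraticTwist`: `b₂ = b₄ = 0`, `b₆ = 4a + 1`). [folklore] -/
theorem quadraticTwist_cubicA₃ (d : ℚ) :
    (cubicA₃ a).quadraticTwist d = ⟨0, 0, 0, 0, d ^ 3 * (4 * a + 1) / 4⟩ := by
  ext <;> simp only [WeierstrassCurve.quadraticTwist, cubicA₃, WeierstrassCurve.b₂, WeierstrassCurve.b₄,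
    WeierstrassCurve.b₆] <;> ring

/-- **`j = 0` on every model of every quadratic twist of `E_a`.** [cite: SilvermanAEC2009, X.5 Cor. 5.4] -/
theorem j_eq_zero_of_smul_twist_cubicA₃ {d : ℚ} (hd : d ≠ 0) {W : WeierstrassCurve ℚ} [W.IsElliptic]
    {C : VariableChange ℚ} (hC : C • (cubicA₃ a).quadraticTwist d = W) : W.j = 0 := by
  haveI := (cubicA₃ a).isElliptic_quadraticTwist hd
  subst hC
  rw [variableChange_j, j_quadraticTwist _ hd, cubicA₃_j]

/-- **Every model of every twist of `E_a` has CM** (`j = 0`). [cite: SilvermanAEC2009, Appendix C §11] -/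
theorem hasCM_of_smul_twist_cubicA₃ {d : ℚ} (hd : d ≠ 0) {W : WeierstrassCurve ℚ} [W.IsElliptic]
    {C : VariableChange ℚ} (hC : C • (cubicA₃ a).quadraticTwist d = W) : W.HasCM :=
  hasCM_of_j_eq_zero _ (j_eq_zero_of_smul_twist_cubicA₃ a hd hC)

/-- **`2` is inert in the CM field of every twist of `E_a`** (INERT type of the corner at `2`).
[cite: Cox2013, §5.B Prop. 5.16] -/
theorem cmInert_two_of_smul_twist_cubicA₃ {d : ℚ} (hd : d ≠ 0) {W : WeierstrassCurve ℚ} [W.IsElliptic]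
    {C : VariableChange ℚ} (hC : C • (cubicA₃ a).quadraticTwist d = W) : CMInert W 2 :=
  (cmInert_two_iff_of_hasCM (hasCM_of_smul_twist_cubicA₃ a hd hC)).2
    (Or.inl (by rw [j_eq_zero_of_smul_twist_cubicA₃ a hd hC]; simp [cmFieldDiscrOfJ]))

/-- **`E_a^{(e)} ≅ y² + y = x³ + k` over `ℚ` with `4k + 1 = e³(4a+1)`** (shift `y ↦ y + 1/2`), an
odd-discriminant integral model — exists iff `e ≡ 1 (mod 4)`. [cite: SilvermanAEC2009, III.1] -/
theorem smul_quadraticTwist_cubicA₃_eq {e k : ℤ} (hk : 4 * k + 1 = e ^ 3 * (4 * a + 1)) :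
    (⟨1, 0, 0, 2⁻¹⟩ : VariableChange ℚ) • (cubicA₃ a).quadraticTwist (e : ℚ) = cubicA₃ k := by
  have hkQ : (4 : ℚ) * k + 1 = (e : ℚ) ^ 3 * (4 * a + 1) := by exact_mod_cast hk
  rw [quadraticTwist_cubicA₃]
  ext <;> simp [cubicA₃, variableChange_a₁, variableChange_a₂, variableChange_a₃, variableChange_a₄,
    variableChange_a₆]
  linear_combination (-1 / 4 : ℚ) * hkQ

/-- For `e ≡ 1 (mod 4)`, `e³(4a+1) ≡ 1 (mod 4)`. [folklore] -/
theorem exists_k_twist_cubicA₃ {e : ℤ} (he : e % 4 = 1) : ∃ k : ℤ, 4 * k + 1 = e ^ 3 * (4 * a + 1) := by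
  obtain ⟨m, rfl⟩ : ∃ m : ℤ, e = 4 * m + 1 := ⟨e / 4, by omega⟩
  exact ⟨((4 * m + 1) ^ 3 * (4 * a + 1) - 1) / 4, by ring_nf; omega⟩

/-- **Every `ℚ`-model of `E_a^{(e)}`, `e ≡ 1 (mod 4)`, has GOOD reduction at `2`** (it is a model of
some `E_k`): the families lie in the INERT-GOOD quadrant. [cite: SilvermanAEC2009, VII.5 Prop. 5.1(a)] -/
theorem good_two_of_smul_twist_cubicA₃ {e : ℤ} (he : e % 4 = 1) {W : WeierstrassCurve ℚ} [W.IsElliptic]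
    {C : VariableChange ℚ} (hC : C • (cubicA₃ a).quadraticTwist (e : ℚ) = W) : Good W 2 := by
  obtain ⟨k, hk⟩ := exists_k_twist_cubicA₃ a he
  have e1 := smul_quadraticTwist_cubicA₃_eq a hk
  have hW : (C * (⟨1, 0, 0, 2⁻¹⟩ : VariableChange ℚ)⁻¹) • cubicA₃ k = W := by
    rw [← e1, mul_smul, inv_smul_smul, hC]
  rw [← hW, Good, hasGoodReductionAtPrime_iff_of_variableChange]
  exact good_two_cubicA₃' k

/-- **Placement**: every globally minimal model of `E_a^{(e)}` (`e ≡ 1 (mod 4)`) of analytic rank one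
lies on the leaf `CornerF · 2`, in the INERT-GOOD cell. [folklore] -/
theorem cornerF_two_of_smul_twist_cubicA₃ {e : ℤ} (he0 : e ≠ 0) {W : WeierstrassCurve ℚ} [W.IsElliptic]
    [W.IsGloballyMinimal] {C : VariableChange ℚ} (hC : C • (cubicA₃ a).quadraticTwist (e : ℚ) = W)
    (hr : W.analyticRank = 1) : CornerF W 2 :=
  ⟨hasCM_of_smul_twist_cubicA₃ a (by exact_mod_cast he0) hC, hr, Or.inl rfl⟩

/-! ## §5 `a_ℓ(E_a)` odd `⟺` an even number of cube roots of `−16(4a+1)` mod `ℓ` -/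

/-- **`E_a ≅ y² = x³ + 16(4a+1)`** over `ℚ` (completing the square, `u = 1/2`). [cite: SilvermanAEC2009, III.1] -/
theorem smul_cubicA₃_eq_short :
    (⟨Units.mk0 (2⁻¹ : ℚ) (by norm_num), 0, 0, -2⁻¹⟩ : VariableChange ℚ) • cubicA₃ a =
      shortWeierstrass (0, 16 * (4 * a + 1)) := by
  rw [cubicA₃, shortWeierstrass, CornerFTwo.Atlas.smul_cubicA₃_eq_sextic]
  push_cast
  rfl

/-- `Δ(y² = x³ + 16(4a+1)) = −2¹²·27·(4a+1)²`; a prime `ℓ ∤ 6(4a+1)` does not divide it. [folklore] -/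
theorem not_dvd_Δ_short_cubicA₃ {ℓ : ℕ} (hℓ : ℓ.Prime) (h2 : ℓ ≠ 2) (h3 : ℓ ≠ 3)
    (ha : ¬ (ℓ : ℤ) ∣ 4 * a + 1) :
    ¬ (ℓ : ℤ) ∣ (⟨0, 0, 0, ((0, 16 * (4 * a + 1)) : ℤ × ℤ).1, ((0, 16 * (4 * a + 1)) : ℤ × ℤ).2⟩ :
      WeierstrassCurve ℤ).Δ := by
  have hΔ : (⟨0, 0, 0, ((0, 16 * (4 * a + 1)) : ℤ × ℤ).1, ((0, 16 * (4 * a + 1)) : ℤ × ℤ).2⟩ :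
      WeierstrassCurve ℤ).Δ = -(2 ^ 12 * 3 ^ 3 * (4 * a + 1) ^ 2) := by
    simp only [WeierstrassCurve.Δ, WeierstrassCurve.b₂, WeierstrassCurve.b₄, WeierstrassCurve.b₆,
      WeierstrassCurve.b₈]
    ring
  rw [hΔ, dvd_neg]
  have hℓp : Prime (ℓ : ℤ) := Nat.prime_iff_prime_int.mp hℓ
  have h2' : ¬ (ℓ : ℤ) ∣ 2 := fun hd =>
    h2 ((Nat.prime_dvd_prime_iff_eq hℓ Nat.prime_two).mp (Int.natCast_dvd_natCast.mp (by exact_mod_cast hd)))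
  have h3' : ¬ (ℓ : ℤ) ∣ 3 := fun hd =>
    h3 ((Nat.prime_dvd_prime_iff_eq hℓ Nat.prime_three).mp (Int.natCast_dvd_natCast.mp (by exact_mod_cast hd)))
  intro h
  rcases hℓp.dvd_or_dvd h with h | h
  · rcases hℓp.dvd_or_dvd h with h | h
    · exact h2' (hℓp.dvd_of_dvd_pow h)
    · exact h3' (hℓp.dvd_of_dvd_pow h)
  · exact ha (hℓp.dvd_of_dvd_pow h)

/-- **`a_ℓ(E_a)` is odd iff `x³ = −16(4a+1)` has an even number of solutions in `𝔽_ℓ`** (`ℓ` prime,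
`ℓ ∤ 6(4a+1)`; on a globally minimal `E_a`). For `ℓ ≡ 2 (mod 3)` there is exactly one cube root, so
`a_ℓ` is even; for `ℓ ≡ 1 (mod 3)` the count is `0` or `3`, so `a_ℓ` is odd iff `2(4a+1)` is a
non-cube mod `ℓ` — Kriz–Li's "`Frob_ℓ` of order `3` on `E[2]`".
[cite: KrizLi2019, Def. 4.1 and arXiv:1606.03172 p. 14 L57–58 ("a_ℓ(E) ≡ 1 (mod 2)")] -/
theorem odd_frobeniusTrace_cubicA₃_iff [(cubicA₃ a).IsGloballyMinimal] {ℓ : ℕ} [NeZero ℓ] (hℓ : ℓ.Prime)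
    (h2 : ℓ ≠ 2) (h3 : ℓ ≠ 3) (ha : ¬ (ℓ : ℤ) ∣ 4 * a + 1) :
    Odd ((cubicA₃ a).frobeniusTrace ℓ) ↔
      Even ((Finset.univ.filter fun x : ZMod ℓ => x ^ 3 = -(16 * (4 * (a : ZMod ℓ) + 1))).card) := by
  haveI : Fact ℓ.Prime := ⟨hℓ⟩
  rw [BSZLemma17.frobeniusTrace_eq_of_smul_eq_shortWeierstrass (smul_cubicA₃_eq_short a) ℓ
    (not_dvd_Δ_short_cubicA₃ a hℓ h2 h3 ha), odd_frobeniusTrace_mordell_iff hℓ h2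
    (by simpa using not_dvd_Δ_short_cubicA₃ a hℓ h2 h3 ha)]
  push_cast
  rfl

/-! ## §6 The quadratic field `K`: splitting, the Heegner hypothesis, `𝒩`, the sign clause — GENERIC -/

/-- **A prime `ℓ ≠ 2` with `(d_K/ℓ) = 1` splits in the quadratic field `K`.** [cite: Marcus1977, Ch. 3 Thm. 25] -/
theorem ncard_primesOver_eq_two_of_jacobiSym {K : Type} [Field K] [NumberField K]
    (h2 : Module.finrank ℚ K = 2) {ℓ : ℕ} (hℓ : ℓ.Prime) (hℓ2 : ℓ ≠ 2)
    (hj : jacobiSym (NumberField.discr K) ℓ = 1) : ((Ideal.span {(ℓ : ℤ)}).primesOver (𝓞 K)).ncard = 2 :=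
  (Literature.NumberTheory.QuadraticFields.Quadratic.ncard_primesOver_eq_two_iff_jacobiSym h2 hℓ hℓ2).2 hj

/-- **`2` splits in the quadratic field `K` iff `d_K ≡ 1 (mod 8)`** — the first half of Assumption (★).
[cite: Marcus1977, Ch. 3 Thm. 25] -/
theorem ncard_primesOver_two_eq_two_of_discr {K : Type} [Field K] [NumberField K]
    (h2 : Module.finrank ℚ K = 2) (h8 : NumberField.discr K % 8 = 1) :
    ((Ideal.span {(2 : ℤ)}).primesOver (𝓞 K)).ncard = 2 :=
  (Literature.NumberTheory.QuadraticFields.Quadratic.ncard_primesOver_two_eq_two_iff h2).2 h8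

/-- **The Heegner hypothesis for `N` from Kronecker symbols at the primes of a multiple `B` of `N`**:
if `N ∣ B`, every odd prime `q ∣ B` has `(d_K/q) = 1`, and `d_K ≡ 1 (mod 8)` in case `2 ∣ B`, then
every prime of `N` splits in `K`. [cite: KrizLi2019, §1 ("each prime factor ℓ of N is split in K")]
[cite: Marcus1977, Ch. 3 Thm. 25] -/
theorem satisfiesHeegnerHypothesis_of_dvd {K : Type} [Field K] [NumberField K]
    (h2 : Module.finrank ℚ K = 2) {N B : ℕ} (hNB : N ∣ B)
    (hodd : ∀ q : ℕ, q.Prime → q ∣ B → q ≠ 2 → jacobiSym (NumberField.discr K) q = 1)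
    (htwo : 2 ∣ B → NumberField.discr K % 8 = 1) : SatisfiesHeegnerHypothesis N K := by
  refine SatisfiesHeegnerHypothesis.of_dvd hNB ?_
  rw [satisfiesHeegnerHypothesis_iff_kronecker _ K h2]
  intro q hq hqB
  exact ⟨fun h => htwo (h ▸ hqB), fun h => hodd q hq hqB h⟩

/-- **`ℓ ∈ 𝒮` from explicit data** (Kriz–Li Def 4.1): `ℓ` prime, `ℓ ∤ 2N`, `(d_K/ℓ) = 1`, `a_ℓ` odd.
[cite: KrizLi2019, Def. 4.1 (FMS) = arXiv Def. 3.1] -/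
theorem inS_of_explicit {W : WeierstrassCurve ℚ} [W.IsGloballyMinimal] {K : Type} [Field K] [NumberField K]
    (h2 : Module.finrank ℚ K = 2) {ℓ : ℕ} (hℓ : ℓ.Prime) (hℓ2 : ℓ ≠ 2) (hN : ¬ ℓ ∣ 2 * W.conductorNorm ℤ)
    (hj : jacobiSym (NumberField.discr K) ℓ = 1) (hodd : Odd (W.frobeniusTrace ℓ)) : KrizLi2019.InS W K ℓ :=
  ⟨hℓ, hN, ncard_primesOver_eq_two_of_jacobiSym h2 hℓ hℓ2 hj, hodd⟩

/-- **`d ∈ 𝒩` from explicit data on the prime factors** (Kriz–Li Def 4.1: `d ≡ 1 (mod 4)`, `|d|` a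
square-free product of primes in `𝒮`), for any predicate `S` implying membership in `𝒮`.
[cite: KrizLi2019, Def. 4.1 (FMS) = arXiv Def. 3.1] -/
theorem inN_of_explicit {W : WeierstrassCurve ℚ} [W.IsGloballyMinimal] {K : Type} [Field K] [NumberField K]
    {S : ℕ → Prop} (hS : ∀ ℓ, S ℓ → KrizLi2019.InS W K ℓ) {d : ℤ} (hd4 : d % 4 = 1)
    (hsq : Squarefree d.natAbs) (hprimes : ∀ ℓ : ℕ, ℓ.Prime → ℓ ∣ d.natAbs → S ℓ) : KrizLi2019.InN W K d :=
  ⟨hd4, hsq, fun ℓ hℓ hℓd => hS ℓ (hprimes ℓ hℓ hℓd)⟩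

/-- `(3ᵏ/d) = 1` for `d > 0`, `d ≡ 1 (mod 12)` (`(3/d) = (d/3) = (1/3)` by reciprocity). [folklore] -/
theorem jacobiSym_three_pow_eq_one {d : ℤ} (hd0 : 0 < d) (hd12 : d % 12 = 1) (k : ℕ) :
    jacobiSym (3 ^ k) d.natAbs = 1 := by
  rw [jacobiSym.pow_left]
  have hn4 : d.natAbs % 4 = 1 := by omega
  have hn3 : (d.natAbs : ℤ) % ((3 : ℕ) : ℤ) = 1 % ((3 : ℕ) : ℤ) := by
    change (d.natAbs : ℤ) % 3 = 1 % 3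
    omega
  have h3 : jacobiSym 3 d.natAbs = 1 := by
    have hrec := jacobiSym.quadratic_reciprocity_one_mod_four' (a := 3) (b := d.natAbs) (by decide) hn4
    rw [Nat.cast_ofNat] at hrec
    rw [hrec, jacobiSym.mod_left, hn3, ← jacobiSym.mod_left, jacobiSym.one_left]
  rw [h3, one_pow]

/-- **The sign clause `χ_d(−N) = sgn(d)·(N/|d|) = 1`** for POSITIVE `d ≡ 1 (mod 12)` whenever
`N = 3ᵏ · m²` with `gcd(m, d) = 1` — whatever the (kernel-unknown) exponent `k` is.
[cite: KrizLi2019, Thm. 5.1 (2) condition "χ_d(−N) = 1"] -/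
theorem sign_mul_jacobiSym_eq_one_of_eq_pow_mul_sq {N : ℕ} {k m : ℕ} (hN : N = 3 ^ k * m ^ 2) {d : ℤ}
    (hd0 : 0 < d) (hd12 : d % 12 = 1) (hmd : Nat.Coprime m d.natAbs) :
    Int.sign d * jacobiSym N d.natAbs = 1 := by
  rw [hN, Int.sign_eq_one_of_pos hd0, one_mul, Nat.cast_mul, Nat.cast_pow, Nat.cast_pow, Nat.cast_ofNat,
    jacobiSym.mul_left, jacobiSym_three_pow_eq_one hd0 hd12, one_mul]
  exact jacobiSym.sq_one' (by rw [Int.gcd_natCast_natCast]; exact hmd)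

end Summit.BirchSwinnertonDyer.Rank1Residual.P2
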